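import Summits.CriticalPhenomena.PercolationContinuityZ3.Theorems.PercNearOneGluingNoHeavyLowerTailCubicFourPointL1CertPatterns
import Literature.Probability.Percolation.Crossings
import Mathlib.MeasureTheory.Measure.Real
import HarnessLib

/-!
# MODE B, XVII: the far-cell pattern layer — the 15 connectivity patterns of `(x,y,b,c)` INSIDE a vertex set `S`

Support file for the Sahi programme (`--supports stmt-CriticalPhenomena-4575`, prover prim-sahi-p2 gen 28).  No sorries, no named facts,
no `native_decide`.  This is the semantic dictionary for the 15 far-cell variables `0..14` of the (FX)/(FY) certificate kernel
`…IncStarTwoCutFXCertKernel` (cell order of gen 26's `cells4.py`: 0 `x|y|b|c`, 1 `x|y|bc`, 2 `x|yb|c`, 3 `x|ybc`, 4 `x|yc|b`, 5 `xy|b|c`,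
6 `xy|bc`, 7 `xyb|c`, 8 `xybc`, 9 `xyc|b`, 10 `xb|y|c`, 11 `xb|yc`, 12 `xbc|y`, 13 `xc|y|b`, 14 `xc|yb`; labels `0=x, 1=y, 2=b, 3=c`, pairs
`0=xy, 1=xb, 2=xc, 3=yb, 4=yc, 5=bc` — the pair numbering of `FourPointCert.pairIdx`).  It is the companion of `…CubicFourPointL1CertPatterns`
(whose tables `patOfBits`, `cons6`, `maskOf`, `msum` are reused) with two differences: the cell order, and the connection events, which are the
connections `openConnIn S` INSIDE a vertex set `S` (for the far side of a two-cut, `S = Rᶜ`).  Contents: `fpat S x y b c ω < 15` (pattern index),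
`fjn (fpat ω) u v ↔ lab u ~ lab v in S` (`fjn_fpat_iff`), mask events `fpre`, up-closed masks give increasing events (`isUpperSet_fpre`),
the cell law `fcellLaw` with `P(fpre T) = msum T fcellLaw` (`real_fpre`), and the connection masks `fconnMask` (`fpre_fconnMask`).
-/

namespace Summit.CriticalPhenomena.PercolationContinuityZ3.Theorems

namespace IncStarTwoCut.FarCert

open MeasureTheory Finset Literature.Probability.Percolation Literature.Probability.LatticeModels FourPointCert

/-! ### Tables in the `cells4` order -/

/-- `fjoinedTab[π]` = 6-bit mask of the pairs joined in the far cell `π`. [this work] -/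
def fjoinedTab : List ℕ := [0, 32, 8, 56, 16, 1, 33, 11, 63, 21, 2, 18, 38, 4, 12]

/-- Pairs joined in the far cell `π`. [this work] -/
def fjoined (π k : ℕ) : Bool := (fjoinedTab.getD π 0).testBit k

/-- Far-cell index of a 6-bit connection vector (bits `xy xb xc yb yc bc`; inconsistent vectors go to their transitive closure). [this work] -/
def fpatTab : List ℕ :=
  [0, 5, 10, 7, 13, 9, 12, 8, 2, 7, 7, 7, 14, 8, 8, 8, 4, 9, 11, 8, 9, 9, 8, 8, 3, 8, 8, 8, 8, 8, 8, 8,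
   1, 6, 12, 8, 12, 8, 12, 8, 3, 8, 8, 8, 8, 8, 8, 8, 3, 8, 8, 8, 8, 8, 8, 8, 3, 8, 8, 8, 8, 8, 8, 8]

/-- The far cell of a bit vector. [this work] -/
def fpatOfBits (b0 b1 b2 b3 b4 b5 : Bool) : ℕ := fpatTab.getD (bidx b0 b1 b2 b3 b4 b5) 0

/-- Far cells are below 15. [this work] -/
theorem fpatOfBits_lt (b0 b1 b2 b3 b4 b5 : Bool) : fpatOfBits b0 b1 b2 b3 b4 b5 < 15 := by
  revert b0 b1 b2 b3 b4 b5; decide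

/-- On consistent bit vectors the table reproduces the bits. [this work] -/
theorem fjoined_fpatOfBits : ∀ (b0 b1 b2 b3 b4 b5 : Bool), cons6 b0 b1 b2 b3 b4 b5 = true →
    ∀ k < 6, fjoined (fpatOfBits b0 b1 b2 b3 b4 b5) k = bitOf k b0 b1 b2 b3 b4 b5 := by
  decide

/-- Are labels `u, v` joined in the far cell `π` (reflexive)? [this work] -/
def fjn (π u v : ℕ) : Bool := if u = v then true else fjoined π (pairIdx u v)

/-- The connection event `{u ~ v}` as a far-cell mask. [this work] -/
def fconnMask (u v : ℕ) : ℕ := maskOf fun π => fjn π u v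

/-- Up-closed far mask. [this work] -/
def fisUp (T : ℕ) : Bool :=
  (List.range 15).all fun π => (List.range 15).all fun π' =>
    !((List.range 6).all fun k => !fjoined π k || fjoined π' k) || !T.testBit π || T.testBit π'

/-- Specification of `fisUp`. [this work] -/
theorem fisUp_spec {T : ℕ} (hT : fisUp T = true) {π π' : ℕ} (hπ : π < 15) (hπ' : π' < 15)
    (hk : ∀ k < 6, fjoined π k = true → fjoined π' k = true) (h : T.testBit π = true) : T.testBit π' = true := by
  simp [fisUp] at hT
  rcases hT π hπ π' hπ' with (⟨k, hk6, hj, hj'⟩ | hπT) | hπ'T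
  · have := hk k hk6 hj; rw [hj'] at this; exact absurd this Bool.false_ne_true
  · rw [hπT] at h; exact absurd h Bool.false_ne_true
  · exact hπ'T

/-! ### The far pattern of a configuration: connections inside `S` -/

open scoped Classical

variable {V : Type*} (S : Set V) (x y b c : V)

/-- Connection bit of two labels INSIDE `S`. [this work] -/
noncomputable def fcb (ω : BondConfig V) (u v : ℕ) : Bool := decide (ω ∈ openConnIn S (lab x y b c u) (lab x y b c v))

/-- **The far pattern** of `(x,y,b,c)` in `ω` inside `S` (an index `< 15`, `cells4` order). [this work] -/
noncomputable def fpat (ω : BondConfig V) : ℕ :=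
  fpatOfBits (fcb S x y b c ω 0 1) (fcb S x y b c ω 0 2) (fcb S x y b c ω 0 3) (fcb S x y b c ω 1 2) (fcb S x y b c ω 1 3)
    (fcb S x y b c ω 2 3)

/-- `openConnIn` is symmetric. [folklore] -/
theorem openConnIn_symm' {ω : BondConfig V} {p q : V} (h : ω ∈ openConnIn S p q) : ω ∈ openConnIn S q p := by
  obtain ⟨hp, hq, hr⟩ := h; exact ⟨hq, hp, hr.symm⟩

/-- `openConnIn` is transitive. [folklore] -/
theorem openConnIn_trans' {ω : BondConfig V} {p q r : V} (h₁ : ω ∈ openConnIn S p q) (h₂ : ω ∈ openConnIn S q r) :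
    ω ∈ openConnIn S p r := by
  obtain ⟨hp, hq, hr⟩ := h₁; obtain ⟨hq', hr', hr2⟩ := h₂; exact ⟨hp, hr', hr.trans hr2⟩

/-- `fcb` is symmetric. [this work] -/
theorem fcb_comm (ω : BondConfig V) (u v : ℕ) : fcb S x y b c ω u v = fcb S x y b c ω v u := by
  simp only [fcb]
  exact Bool.decide_congr ⟨fun h => openConnIn_symm' S h, fun h => openConnIn_symm' S h⟩

/-- The connection bits inside `S` are consistent. [this work] -/
theorem cons6_fcb (ω : BondConfig V) :
    cons6 (fcb S x y b c ω 0 1) (fcb S x y b c ω 0 2) (fcb S x y b c ω 0 3) (fcb S x y b c ω 1 2) (fcb S x y b c ω 1 3)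
      (fcb S x y b c ω 2 3) = true := by
  have T : ∀ {p q r : V}, ω ∈ openConnIn S p q → ω ∈ openConnIn S q r → ω ∈ openConnIn S p r := fun h1 h2 => openConnIn_trans' S h1 h2
  have Sy : ∀ {p q : V}, ω ∈ openConnIn S p q → ω ∈ openConnIn S q p := fun h => openConnIn_symm' S h
  simp only [cons6, fcb, lab, Bool.and_eq_true]
  refine ⟨⟨⟨⟨⟨⟨⟨⟨⟨⟨⟨imp3_of fun h1 h2 => T h1 h2, imp3_of fun h1 h2 => T (Sy h1) h2⟩, imp3_of fun h1 h2 => T h1 (Sy h2)⟩,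
    imp3_of fun h1 h2 => T h1 h2⟩, imp3_of fun h1 h2 => T (Sy h1) h2⟩, imp3_of fun h1 h2 => T h1 (Sy h2)⟩,
    imp3_of fun h1 h2 => T h1 h2⟩, imp3_of fun h1 h2 => T (Sy h1) h2⟩, imp3_of fun h1 h2 => T h1 (Sy h2)⟩,
    imp3_of fun h1 h2 => T h1 h2⟩, imp3_of fun h1 h2 => T (Sy h1) h2⟩, imp3_of fun h1 h2 => T h1 (Sy h2)⟩

/-- Far patterns are below 15. [this work] -/
theorem fpat_lt (ω : BondConfig V) : fpat S x y b c ω < 15 := fpatOfBits_lt _ _ _ _ _ _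

/-- The joined pairs of the far pattern are the connection bits. [this work] -/
theorem fjoined_fpat (ω : BondConfig V) {k : ℕ} (hk : k < 6) :
    fjoined (fpat S x y b c ω) k = bitOf k (fcb S x y b c ω 0 1) (fcb S x y b c ω 0 2) (fcb S x y b c ω 0 3) (fcb S x y b c ω 1 2)
      (fcb S x y b c ω 1 3) (fcb S x y b c ω 2 3) :=
  fjoined_fpatOfBits _ _ _ _ _ _ (cons6_fcb S x y b c ω) k hk

/-- **The far pattern has the right joined pairs** (distinct label indices `u, v < 4`). [this work] -/
theorem fjn_fpat (ω : BondConfig V) {u v : ℕ} (hu : u < 4) (hv : v < 4) (huv : u ≠ v) :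
    fjn (fpat S x y b c ω) u v = fcb S x y b c ω u v := by
  have k0 := fjoined_fpat S x y b c ω (show 0 < 6 by norm_num)
  have k1 := fjoined_fpat S x y b c ω (show 1 < 6 by norm_num)
  have k2 := fjoined_fpat S x y b c ω (show 2 < 6 by norm_num)
  have k3 := fjoined_fpat S x y b c ω (show 3 < 6 by norm_num)
  have k4 := fjoined_fpat S x y b c ω (show 4 < 6 by norm_num)
  have k5 := fjoined_fpat S x y b c ω (show 5 < 6 by norm_num)
  simp only [bitOf] at k0 k1 k2 k3 k4 k5
  have hp := pairIdx_vals
  unfold fjn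
  rw [if_neg huv]
  interval_cases u <;> interval_cases v <;> first | exact absurd rfl huv |
    simp only [hp, k0, k1, k2, k3, k4, k5, fcb_comm S x y b c ω 1 0, fcb_comm S x y b c ω 2 0, fcb_comm S x y b c ω 3 0,
      fcb_comm S x y b c ω 2 1, fcb_comm S x y b c ω 3 1, fcb_comm S x y b c ω 3 2]

/-- Membership form of `fjn_fpat`: for `u ≠ v`, or when the label lies in `S`, `fjn (fpat ω) u v ↔ lab u ~ lab v in S`. [this work] -/
theorem fjn_fpat_iff (ω : BondConfig V) {u v : ℕ} (hu : u < 4) (hv : v < 4) (huv : u ≠ v ∨ lab x y b c u ∈ S) :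
    fjn (fpat S x y b c ω) u v = true ↔ ω ∈ openConnIn S (lab x y b c u) (lab x y b c v) := by
  by_cases h : u = v
  · subst h
    have hm : lab x y b c u ∈ S := huv.resolve_left fun h => h rfl
    simp only [fjn, ↓reduceIte, true_iff]
    exact ⟨hm, hm, SimpleGraph.Reachable.refl _⟩
  · rw [fjn_fpat S x y b c ω hu hv h, fcb, decide_eq_true_eq]

/-- Negated membership form. [this work] -/
theorem fjn_fpat_false_iff (ω : BondConfig V) {u v : ℕ} (hu : u < 4) (hv : v < 4) (huv : u ≠ v ∨ lab x y b c u ∈ S) :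
    fjn (fpat S x y b c ω) u v = false ↔ ω ∉ openConnIn S (lab x y b c u) (lab x y b c v) := by
  rw [← fjn_fpat_iff S x y b c ω hu hv huv, Bool.eq_false_iff]

/-! ### Mask events -/

/-- The event "the far pattern lies in the mask `T`". [this work] -/
def fpre (T : ℕ) : Set (BondConfig V) := {ω | T.testBit (fpat S x y b c ω) = true}

/-- Membership in `fpre`. [this work] -/
@[simp] theorem mem_fpre (T : ℕ) (ω : BondConfig V) : ω ∈ fpre S x y b c T ↔ T.testBit (fpat S x y b c ω) = true := Iff.rfl

/-- `fpre` of an intersection of masks. [this work] -/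
theorem fpre_and (T₁ T₂ : ℕ) : fpre S x y b c (T₁ &&& T₂) = fpre S x y b c T₁ ∩ fpre S x y b c T₂ := by
  ext ω; simp [fpre, Nat.testBit_and]

/-- `fpre` of a union of masks. [this work] -/
theorem fpre_or (T₁ T₂ : ℕ) : fpre S x y b c (T₁ ||| T₂) = fpre S x y b c T₁ ∪ fpre S x y b c T₂ := by
  ext ω; simp [fpre, Nat.testBit_or]

/-- `fpre` of the complement within `full`. [this work] -/
theorem fpre_xor_full (T : ℕ) : fpre S x y b c (full ^^^ T) = (fpre S x y b c T)ᶜ := by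
  ext ω; simp [fpre, Nat.testBit_xor, testBit_full, fpat_lt]

/-- `fpre full` is everything. [this work] -/
theorem fpre_full : fpre S x y b c full = Set.univ := by
  ext ω; simp [fpre, testBit_full, fpat_lt]

/-- `fpre (maskOf P)` is the event `P (fpat ω)`. [this work] -/
theorem mem_fpre_maskOf (P : ℕ → Bool) (ω : BondConfig V) : ω ∈ fpre S x y b c (maskOf P) ↔ P (fpat S x y b c ω) = true := by
  simp [fpre, testBit_maskOf, fpat_lt]

/-- Joined pairs are monotone in the configuration. [this work] -/
theorem fjoined_fpat_mono {ω ω' : BondConfig V} (hle : ω ≤ ω') {k : ℕ} (hk : k < 6) (h : fjoined (fpat S x y b c ω) k = true) :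
    fjoined (fpat S x y b c ω') k = true := by
  rw [fjoined_fpat S x y b c ω hk] at h
  rw [fjoined_fpat S x y b c ω' hk]
  interval_cases k <;> simp only [bitOf, fcb, decide_eq_true_eq] at h ⊢ <;> exact isUpperSet_openConnIn S _ _ hle h

/-- **An up-closed far mask gives an increasing event.** [this work] -/
theorem isUpperSet_fpre {T : ℕ} (hT : fisUp T = true) : IsUpperSet (fpre S x y b c T) := fun _ _ hle hω =>
  fisUp_spec hT (fpat_lt S x y b c _) (fpat_lt S x y b c _) (fun _ hk h => fjoined_fpat_mono S x y b c hle hk h) hω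

/-- `fpre T` as a preimage of a finite set of patterns. [this work] -/
theorem fpre_eq_preimage (T : ℕ) :
    fpre S x y b c T = fpat S x y b c ⁻¹' (↑((range 15).filter fun π => T.testBit π = true) : Set ℕ) := by
  ext ω
  simp only [mem_fpre, Set.mem_preimage, Finset.coe_filter, Finset.mem_range, Set.mem_setOf_eq, fpat_lt, true_and]

/-- **Connection masks are connection events**: `fpre (fconnMask u v) = {lab u ~ lab v in S}` (`u ≠ v`). [this work] -/
theorem fpre_fconnMask {u v : ℕ} (hu : u < 4) (hv : v < 4) (huv : u ≠ v) :
    fpre S x y b c (fconnMask u v) = openConnIn S (lab x y b c u) (lab x y b c v) := by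
  ext ω; rw [fconnMask, mem_fpre_maskOf, fjn_fpat_iff S x y b c ω hu hv (Or.inl huv)]

/-! ### The law of the far cells -/

variable (w : Sym2 V → unitInterval)

/-- **The law of the 15 far cells**: `fcellLaw π = P(far pattern = π)` (zero for `π ≥ 15`). [this work] -/
noncomputable def fcellLaw (π : ℕ) : ℝ := (prodBernoulli w).real (fpat S x y b c ⁻¹' {π})

/-- Far cells are nonnegative. [this work] -/
theorem fcellLaw_nonneg (π : ℕ) : 0 ≤ fcellLaw S x y b c w π := measureReal_nonneg

variable [Fintype V]

/-- **Dictionary**: the probability of a far mask event is the mask sum of the far cell law. [this work] -/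
theorem real_fpre (T : ℕ) : (prodBernoulli w).real (fpre S x y b c T) = msum T (fcellLaw S x y b c w) := by
  rw [fpre_eq_preimage, ← sum_measureReal_preimage_singleton _ (fun π _ => measurableSet_of_fintype _), msum, Finset.sum_filter]
  rfl

/-- The far cells sum to one. [this work] -/
theorem msum_full_fcellLaw : msum full (fcellLaw S x y b c w) = 1 := by
  rw [← real_fpre, fpre_full, probReal_univ]

end IncStarTwoCut.FarCert

end Summit.CriticalPhenomena.PercolationContinuityZ3.Theorems
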